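import Summits.BirchSwinnertonDyer.Rank1Residual.X1.KellerYinIMC2Halves
import Summits.BirchSwinnertonDyer.Rank1Residual.X1.LambdaSqueezeAlgebra
import Summits.BirchSwinnertonDyer.Rank1Residual.X11a.LambdaNorm
import HarnessLib

/-!
# Route `EisensteinPrimes` (rung K5), crux 2 `GoodLatticeBDPValue`, line `halves`, stub `stub_muLambda`:
# the WEIERSTRASS DICTIONARY between the module invariants `μ(X) = 0`, `λ(X) = n` of a torsion
# `Λ`-module and the "first unit coefficient at `n`" currency of `GoodLatticeMuLambdaOnTree`

Cell `bsd-eis` (FULL-BSD rank-≤1 programme, `run/shared/lean/pub/bsd-eis/`), seat `bsd-eis-k5-c2`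
(D-0074 group (C) row A). The registered stub of the line `halves` is
`∀ W p, X1.KellerYinHalves.GoodLatticeMuLambdaOnTree W p`: for every generator `F` of
`char_Λ(𝔛_E)` and every BDP frame `L`, the first unit coefficient of `map toUnr F ∈ R₀⟦T⟧` and of
`L` sit at the same index. Keller–Yin's Thm. 1.5.1 (`algmain`) and the character main conjectures,
like every Greenberg–Vatsal-type statement in the tree (`GreenbergVatsal2000.lambda_nonPrimitive_eq_add_sum_delta`),
speak instead of the INVARIANTS of the `Λ`-MODULE: `𝔛` finitely generated and torsion, `μ(𝔛) = 0`,
`λ(𝔛) = n` (`muInvariant`, `lambdaInvariant`). This file proves, once and for all, the passage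
between the two currencies (Washington §13.2 + §7.1, ALL in the kernel from tree theorems):

* `hasUnitContent_of_mu_eq_zero'` — `g ≠ 0`, `μ(g) = 0` ⟹ unit content (local copy of the
  three-line X11a lemma, to keep the import closure on the X1 side);
* `firstUnitCoeff_of_charIdeal_eq_span` — for a finitely generated torsion `Λ`-module `M` with
  `μ(M) = 0` and `char_Λ M = (F)`: `‖[T^{λ(M)}]F‖ = 1 ∧ ∀ i < λ(M), ‖[Tⁱ]F‖ < 1` in `ℤ_p`
  (`X1.MuPart.mu_generator_eq_muInvariant`, `X1.ParitySqueeze.lam_generator_eq_lambdaInvariant`,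
  `X11a.LambdaNorm.lam_eq_normLam` + `norm_coeff_normLam_eq_one` + `norm_coeff_lt_of_lt_normLam`);
* `firstUnitCoeff_map_toUnr_of_charIdeal_eq_span` — the same read in `R₀ ⊂ ℂ_p` along the
  structure map `toUnr : ℤ_p → R₀` (an isometry: `coe_toUnr`, `norm_algebraMap'`), i.e. EXACTLY the
  `F`-half of the conclusion of `GoodLatticeMuLambdaOnTree`;
* `firstUnitCoeff_map_toUnr_iff` — conversely the coefficient shape at `n` forces `μ(M) = 0` and
  `λ(M) = n` (so the two currencies are equivalent, `firstUnitCoeff_unique`).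

Nothing about any curve is asserted; THEOREMS ONLY; helper attached to stmt-BirchSwinnertonDyer-19032
(`--supports`). References: [Washington1997] §7.1 Prop. 7.2 / Thm. 7.3, §13.2 (Thm. 13.12);
[GreenbergVatsal2000] p. 2 (1)–(2).
-/

set_option autoImplicit false
set_option linter.dupNamespace false

noncomputable section

open scoped Classical

open PowerSeries Literature.NumberTheory.EllipticCurves
  Literature.NumberTheory.EllipticCurves.GreenbergVatsal2000
  Summit.BirchSwinnertonDyer.Rank1Residual.X11b.Halves
  Summit.BirchSwinnertonDyer.Rank1Residual Summit.BirchSwinnertonDyer.Rank1Residual.X1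

namespace Summit.BirchSwinnertonDyer.BirchSwinnertonDyer.Theorems.EisensteinPrimesMuLambda

variable {p : ℕ} [Fact p.Prime]

/-- A non-zero `g ∈ Λ = ℤ_p⟦T⟧` with `μ(g) = 0` has unit content (`p ∤ g`: Greenberg–Vatsal (2),
"`p^{μ}` is the exact power of `p` dividing `f(T)`"). Local copy of
`X11a.MuLambdaSplit.hasUnitContent_of_mu_eq_zero` (kept here to avoid importing the class-X11a
certificate files into the crux-2 helper). [cite: GreenbergVatsal2000, p. 2, (2)] -/
theorem hasUnitContent_of_mu_eq_zero' {g : IwasawaAlgebra p} (hg : g ≠ 0) (h : MuLambda.mu g = 0) :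
    HasUnitContent g := by
  rw [hasUnitContent_iff_not_C_dvd]
  intro hdvd
  have h1 : 1 ≤ MuLambda.mu g := MuLambda.le_mu_of_C_pow_dvd hg (n := 1) (by rwa [pow_one])
  omega

/-- A generator of the characteristic ideal of a `Λ`-module is non-zero (`char_Λ M ≠ 0` over the
domain `Λ`, tree theorem `Module.charIdeal_ne_bot`). [cite: Washington1997, §13.2] -/
theorem generator_ne_zero {M : Type*} [AddCommGroup M] [Module (IwasawaAlgebra p) M]
    {F : IwasawaAlgebra p}
    (hF : Literature.NumberTheory.EllipticCurves.Module.charIdeal (IwasawaAlgebra p) M =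
      Ideal.span {F}) : F ≠ 0 := by
  intro h0
  apply Literature.NumberTheory.EllipticCurves.Module.charIdeal_ne_bot (IwasawaAlgebra p) M
  rw [hF, h0, Ideal.span_singleton_eq_bot]

/-- **Weierstrass dictionary, `ℤ_p`-coefficients.** For a finitely generated torsion `Λ`-module `M`
with `μ(M) = 0` and `char_Λ M = (F)`: the first unit coefficient of `F` sits at `λ(M)` —
`‖[T^{λ(M)}]F‖ = 1` and `‖[Tⁱ]F‖ < 1` for `i < λ(M)` (structure theorem, Washington Thm. 13.12 /
§13.2, and `p`-adic Weierstrass preparation §7.1: `F = unit · ∏ fⱼ^{nⱼ}` with `fⱼ` distinguished,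
`λ(M) = Σ nⱼ deg fⱼ`). [cite: Washington1997, §13.2 and §7.1 (Prop. 7.2, Thm. 7.3)] -/
theorem firstUnitCoeff_of_charIdeal_eq_span (M : Type*) [AddCommGroup M]
    [Module (IwasawaAlgebra p) M] [Module.Finite (IwasawaAlgebra p) M]
    (hM : Module.IsTorsion (IwasawaAlgebra p) M) (hμ : muInvariant p M = 0) {F : IwasawaAlgebra p}
    (hF : Literature.NumberTheory.EllipticCurves.Module.charIdeal (IwasawaAlgebra p) M =
      Ideal.span {F}) :
    ‖coeff (lambdaInvariant p M) F‖ = 1 ∧ ∀ i < lambdaInvariant p M, ‖coeff i F‖ < 1 := by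
  have hF0 : F ≠ 0 := generator_ne_zero hF
  have hmu : MuLambda.mu F = 0 := by rw [MuPart.mu_generator_eq_muInvariant M hM hF0 hF, hμ]
  have huc : HasUnitContent F := hasUnitContent_of_mu_eq_zero' hF0 hmu
  have h1 : ∃ n, ‖coeff n F‖ = 1 := (hasUnitContent_iff_exists_norm_eq_one F).mp huc
  have hn : normLam F = lambdaInvariant p M := by
    rw [← X11a.LambdaNorm.lam_eq_normLam huc, ParitySqueeze.lam_generator_eq_lambdaInvariant M hM hF0 hF]
  have hone : ‖coeff (normLam F) F‖ = 1 := X11a.LambdaNorm.norm_coeff_normLam_eq_one h1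
  refine ⟨hn ▸ hone, fun i hi ↦ ?_⟩
  have hlt := X11a.LambdaNorm.norm_coeff_lt_of_lt_normLam (F := F) (m := i) (hn.symm ▸ hi)
  rwa [hone] at hlt

/-- The structure map `toUnr : ℤ_p → R₀ ⊂ ℂ_p` is an isometry on coefficients:
`‖[Tⁱ](map toUnr F)‖_{ℂ_p} = ‖[Tⁱ]F‖_{ℤ_p}`. [folklore] -/
theorem norm_coeff_map_toUnr (F : IwasawaAlgebra p) (i : ℕ) :
    ‖((coeff i (PowerSeries.map (toUnr p) F) : unrIntegers p) : ℂ_[p])‖ = ‖coeff i F‖ := by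
  rw [coeff_map, coe_toUnr, norm_algebraMap', PadicInt.norm_def]

/-- **Weierstrass dictionary read in `R₀⟦T⟧`** — exactly the `F`-half of the conclusion of
`X1.KellerYinHalves.GoodLatticeMuLambdaOnTree`: for a finitely generated torsion `Λ`-module `M` with
`μ(M) = 0` and `char_Λ M = (F)`, the first unit coefficient of `map toUnr F` (coefficients read in
`ℂ_p`) sits at `λ(M)`. [cite: Washington1997, §13.2 and §7.1 (Prop. 7.2, Thm. 7.3)] -/
theorem firstUnitCoeff_map_toUnr_of_charIdeal_eq_span (M : Type*) [AddCommGroup M]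
    [Module (IwasawaAlgebra p) M] [Module.Finite (IwasawaAlgebra p) M]
    (hM : Module.IsTorsion (IwasawaAlgebra p) M) (hμ : muInvariant p M = 0) {F : IwasawaAlgebra p}
    (hF : Literature.NumberTheory.EllipticCurves.Module.charIdeal (IwasawaAlgebra p) M =
      Ideal.span {F}) :
    ‖((coeff (lambdaInvariant p M) (PowerSeries.map (toUnr p) F) : unrIntegers p) : ℂ_[p])‖ = 1 ∧
      ∀ i < lambdaInvariant p M,
        ‖((coeff i (PowerSeries.map (toUnr p) F) : unrIntegers p) : ℂ_[p])‖ < 1 := by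
  obtain ⟨h1, h2⟩ := firstUnitCoeff_of_charIdeal_eq_span M hM hμ hF
  exact ⟨by rw [norm_coeff_map_toUnr]; exact h1, fun i hi ↦ by rw [norm_coeff_map_toUnr]; exact h2 i hi⟩

/-- **Converse.** If `char_Λ M = (F)` for a finitely generated torsion `M` and the first unit
coefficient of `map toUnr F` sits at `n`, then `μ(M) = 0` and `λ(M) = n` (a unit coefficient gives
unit content, i.e. `μ(F) = 0 = μ(M)`; then the index is `λ(M)` by uniqueness of the first unit
coefficient). So the two currencies are equivalent. [cite: Washington1997, §13.2 and §7.1] -/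
theorem mu_eq_zero_and_lambda_eq_of_firstUnitCoeff_map_toUnr (M : Type*) [AddCommGroup M]
    [Module (IwasawaAlgebra p) M] [Module.Finite (IwasawaAlgebra p) M]
    (hM : Module.IsTorsion (IwasawaAlgebra p) M) {F : IwasawaAlgebra p}
    (hF : Literature.NumberTheory.EllipticCurves.Module.charIdeal (IwasawaAlgebra p) M =
      Ideal.span {F}) {n : ℕ}
    (hn : ‖((coeff n (PowerSeries.map (toUnr p) F) : unrIntegers p) : ℂ_[p])‖ = 1 ∧
      ∀ i < n, ‖((coeff i (PowerSeries.map (toUnr p) F) : unrIntegers p) : ℂ_[p])‖ < 1) :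
    muInvariant p M = 0 ∧ lambdaInvariant p M = n := by
  have hF0 : F ≠ 0 := generator_ne_zero hF
  have huc : HasUnitContent F := by
    rw [hasUnitContent_iff_exists_norm_eq_one]
    exact ⟨n, by rw [← norm_coeff_map_toUnr]; exact hn.1⟩
  have hμ : muInvariant p M = 0 := by
    rw [← MuPart.mu_generator_eq_muInvariant M hM hF0 hF]
    by_contra hne
    obtain ⟨k, hk⟩ := Nat.exists_eq_add_one_of_ne_zero hne
    have hdvd := MuLambda.C_pow_mu_dvd hF0
    rw [hk, pow_succ, map_mul] at hdvd
    exact (hasUnitContent_iff_not_C_dvd F).mp huc (dvd_trans (Dvd.intro_left _ rfl) hdvd)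
  refine ⟨hμ, ?_⟩
  exact KellerYinHalves.firstUnitCoeff_unique (firstUnitCoeff_map_toUnr_of_charIdeal_eq_span M hM hμ hF) hn

end Summit.BirchSwinnertonDyer.BirchSwinnertonDyer.Theorems.EisensteinPrimesMuLambda

end
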